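import Literature.RepresentationTheory.KonnoKonno2007.RealUnitaryDualPairBallFrame
import Literature.NumberTheory.Weil1964.ArchPlacePhaseHom
import Literature.Analysis.SegalBargmann.SchwartzTensorSchur
import HarnessLib

/-!
# The real unitary dual pair under relabelling of its index types: `U(P,Q) × U(R,S) ≅ U(P′,Q′) × U(R′,S′)` and the naturality of `ι𝕎`

Topic `RepresentationTheory/KonnoKonno2007`; namespace `Literature.RepresentationTheory.KonnoKonno2007.RealDualPair`.  KERNEL
MATHEMATICS ONLY: three explicit definitions (topological group isomorphisms / an index bijection) and proved theorems; no
`def … : Prop` record, no axiom, no proof hole.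

The tree's real dual pair `Ginf P Q R S = UForm P Q × UForm R S` and its symplectic action `ι𝕎 P Q R S` on
`ℝ^{DPIdx P Q R S} × ℝ^{DPIdx P Q R S}` (`RealUnitaryDualPair`) are indexed by four finite TYPES.  A consumer whose frames come
as subtypes (`PosIdx x`, `NegIdx x` of a sign vector, `ArchDualPairThetaMajorants`) and who must feed a statement typed on
literal `Fin 2`, `Unit`, … (`RealUnitaryDualPairBallFrame.u21FrameEquiv`, `Model/ArchKTypeJunction`) needs the relabelling
along bijections `eP : P ≃ P′`, `eQ : Q ≃ Q′`, `eR : R ≃ R′`, `eS : S ≃ S′`: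

* §1 `tw`, `twMulVec`, `twRealify` under a relabelling `Equiv.sumCongr e₁ e₂` that respects the two blocks
  (`tw_comp_sumCongr`, `twMulVec_reindex_sumCongr`, **`twRealify_reindex_sumCongr : twRealify (reindex E E M) =
  reindexPhase E⁻¹ (twRealify M)`**) — the general form of `JunctionSwapSymmetry.twMulVec_reindex_swapIdx`;
* §2 **`UForm.relabel e₁ e₂ : UForm α β ≃ₜ* UForm α′ β′`** (`g ↦ reindex (e₁ ⊕ e₂) (e₁ ⊕ e₂) g`; `signForm_submatrix_sumCongr`,
  the tree's `unitaryGroupOfFormReindex` and `subgroupCongrT`), `UForm.toSp_relabel`;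
  **`Ginf.relabel eP eQ eR eS : Ginf P Q R S ≃ₜ* Ginf P′ Q′ R′ S′`**, `dpIdxCongr eP eQ eR eS : DPIdx P Q R S ≃ DPIdx P′ Q′ R′ S′`
  and the NATURALITY **`coe_ι𝕎_relabel : ⇑(ι𝕎 P′ Q′ R′ S′ (Ginf.relabel … g)) = reindexPhase (dpIdxCongr …)⁻¹ ⇑(ι𝕎 P Q R S g)`**,
  as homomorphisms `ι𝕎_relabel : ι𝕎′ (relabel g) = reindexSp (dpIdxCongr …)⁻¹ (ι𝕎 g)` / `reindexSp_dpIdxCongr_ι𝕎_relabel`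
  (`reindexSp` of `Weil1964/ArchPlacePhaseHom`; `reindexSp_reindexSp_symm`, `reindexSp_symm_reindexSp`);
* §3 block phase maps under relabelling: `reindexPhase_refl`, **`reindexPhase_sumCongr_blockPhase`**, and the consumer's step
  **`coe_reindexSp_sumCongr_of_eq_blockPhase`**: from `⇑(Γ h) = blockPhase ⇑(ι𝕎 P Q R S u) id` (the block-pair shape of an
  element supported at one place, `Weil1964/ArchPlacePhaseHomBlock`) to
  `⇑(reindexSp (dpIdxCongr⁻¹ ⊕ 1) (Γ h)) = blockPhase ⇑(ι𝕎 P′ Q′ R′ S′ (relabel u)) id`.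

Everything is PROVED; nothing cited is a hypothesis.

## References

* [KonnoKonno2007] K. Konno, T. Konno, Kyushu J. Math. 61 (2007), §3.1 (3.1) (the embedding `ι_{V,W}`; frames of `U(p,q)`).
* [MoeglinVignerasWaldspurger1987] C. Mœglin, M.-F. Vignéras, J.-L. Waldspurger, LNM 1291 (1987), Ch. 1 I.17.
* [Weil1964] A. Weil, Acta Math. 111 (1964), Chap. I n° 12 p. 160 (direct sums / relabelled symplectic spaces).

## Provenance

LEAN-IN-TREE rule (2026-08-18), pub-hodgecm model-construction sub-cell, discharge seat mc-discharge-3 (ticket D-3 follow-on (T3):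
glue from the (J-arch) datum's canonical sign frames to the literal `U(2,1) = UForm (Fin 2) Unit` frame of the ball model).  Nothing
here is a claim of the manuscripts adjudicated by that cell.
-/

set_option autoImplicit false

noncomputable section

open Matrix
open scoped Kronecker

namespace Literature.RepresentationTheory.KonnoKonno2007

namespace RealDualPair

open Literature.Analysis.SegalBargmann Literature.RepresentationTheory.HeisenbergGroup
open Literature.NumberTheory.Automorphic Literature.NumberTheory.Weil1964

/-! ## §1 The twisted realification under a block-respecting relabelling -/

section Tw

variable {α β α' β' : Type*}

/-- a block-respecting relabelling commutes with the twist. [folklore] -/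
theorem tw_comp_sumCongr (e₁ : α ≃ α') (e₂ : β ≃ β') (x : α' ⊕ β' → ℂ) :
    tw (x ∘ Equiv.sumCongr e₁ e₂) = tw x ∘ Equiv.sumCongr e₁ e₂ := by
  funext i
  rcases i with a | b <;> rfl

/-- … and so does its inverse. [folklore] -/
theorem tw_comp_sumCongr_symm (e₁ : α ≃ α') (e₂ : β ≃ β') (y : α ⊕ β → ℂ) :
    tw (y ∘ (Equiv.sumCongr e₁ e₂).symm) = tw y ∘ (Equiv.sumCongr e₁ e₂).symm := by
  funext i
  rcases i with a | b <;> rfl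

variable [Fintype α] [Fintype β] [Fintype α'] [Fintype β']

/-- twisted action of a relabelled matrix. [folklore] -/
theorem twMulVec_reindex_sumCongr (e₁ : α ≃ α') (e₂ : β ≃ β') (M : Matrix (α ⊕ β) (α ⊕ β) ℂ) (X : α' ⊕ β' → ℂ) :
    twMulVec (Matrix.reindex (Equiv.sumCongr e₁ e₂) (Equiv.sumCongr e₁ e₂) M) X =
      twMulVec M (X ∘ Equiv.sumCongr e₁ e₂) ∘ (Equiv.sumCongr e₁ e₂).symm := by
  rw [twMulVec, twMulVec, Matrix.reindex_apply, Matrix.submatrix_mulVec_equiv, Equiv.symm_symm, ← tw_comp_sumCongr,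
    tw_comp_sumCongr_symm]

/-- **The twisted realification of a relabelled matrix is the relabelled phase map**:
`twRealify (reindex E E M) = reindexPhase E⁻¹ (twRealify M)`, `E = e₁ ⊕ e₂`. [cite: Weil1964, Chap. I n° 12, p. 160] -/
theorem twRealify_reindex_sumCongr (e₁ : α ≃ α') (e₂ : β ≃ β') (M : Matrix (α ⊕ β) (α ⊕ β) ℂ) :
    twRealify (Matrix.reindex (Equiv.sumCongr e₁ e₂) (Equiv.sumCongr e₁ e₂) M) =
      reindexPhase (Equiv.sumCongr e₁ e₂).symm (twRealify M) := by
  funext w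
  rw [reindexPhase_apply, Equiv.symm_symm]
  have hφ : phasePt (w.1 ∘ Equiv.sumCongr e₁ e₂) (w.2 ∘ Equiv.sumCongr e₁ e₂) =
      phasePt w.1 w.2 ∘ Equiv.sumCongr e₁ e₂ := rfl
  refine Prod.ext (funext fun k => ?_) (funext fun k => ?_)
  · show (twMulVec _ (phasePt w.1 w.2) k).re = (twMulVec M (phasePt _ _) _).re
    rw [twMulVec_reindex_sumCongr, hφ]
    rfl
  · show (twMulVec _ (phasePt w.1 w.2) k).im = (twMulVec M (phasePt _ _) _).im
    rw [twMulVec_reindex_sumCongr, hφ]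
    rfl

end Tw

/-! ## §2 `U(P,Q)`, `G_∞` and `ι𝕎` under relabelling -/

section UForm

variable (α β α' β' : Type*) [Fintype α] [DecidableEq α] [Fintype β] [DecidableEq β] [Fintype α'] [DecidableEq α']
  [Fintype β'] [DecidableEq β']

omit [Fintype α] [Fintype β] [Fintype α'] [Fintype β'] in
/-- `diag(1_{α′}, −1_{β′})` relabelled along `e₁ ⊕ e₂` is `diag(1_α, −1_β)`. [folklore] -/
theorem signForm_submatrix_sumCongr (e₁ : α ≃ α') (e₂ : β ≃ β') :
    (signForm α' β').submatrix (Equiv.sumCongr e₁ e₂) (Equiv.sumCongr e₁ e₂) = signForm α β := by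
  ext (i | i) (j | j) <;>
    simp [Matrix.fromBlocks_apply₁₁, Matrix.fromBlocks_apply₁₂, Matrix.fromBlocks_apply₂₁, Matrix.fromBlocks_apply₂₂,
      Matrix.one_apply]

/-- **`U(α, β) ≃ₜ* U(α′, β′)` along `e₁ : α ≃ α′`, `e₂ : β ≃ β′`**: `g ↦ reindex (e₁ ⊕ e₂) (e₁ ⊕ e₂) g`.
[cite: KonnoKonno2007, §3.1] -/
def UForm.relabel (e₁ : α ≃ α') (e₂ : β ≃ β') : UForm α β ≃ₜ* UForm α' β' :=
  (subgroupCongrT (congrArg (unitaryGroupOfForm (starRingEnd ℂ)) (signForm_submatrix_sumCongr α β α' β' e₁ e₂)).symm).trans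
    (unitaryGroupOfFormReindex (starRingEnd ℂ) (Equiv.sumCongr e₁ e₂) (signForm α' β'))

variable {α β α' β'}

/-- matrix of `UForm.relabel e₁ e₂ g`: `reindex (e₁ ⊕ e₂) (e₁ ⊕ e₂) g`. [folklore] -/
@[simp] theorem UForm.coe_relabel (e₁ : α ≃ α') (e₂ : β ≃ β') (g : UForm α β) :
    (((UForm.relabel α β α' β' e₁ e₂ g : UForm α' β') : GL (α' ⊕ β') ℂ) : Matrix (α' ⊕ β') (α' ⊕ β') ℂ) =
      Matrix.reindex (Equiv.sumCongr e₁ e₂) (Equiv.sumCongr e₁ e₂) ((g : GL (α ⊕ β) ℂ) : Matrix (α ⊕ β) (α ⊕ β) ℂ) :=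
  rfl

/-- **`toSp` is natural**: `toSp (relabel g) = reindexSp (e₁ ⊕ e₂)⁻¹ (toSp g)`. [cite: MoeglinVignerasWaldspurger1987, Ch. 1 I.17] -/
theorem UForm.toSp_relabel (e₁ : α ≃ α') (e₂ : β ≃ β') (g : UForm α β) :
    UForm.toSp α' β' (UForm.relabel α β α' β' e₁ e₂ g) = reindexSp (Equiv.sumCongr e₁ e₂).symm (UForm.toSp α β g) := by
  apply Subtype.ext
  apply LinearEquiv.ext
  intro w
  have h := congrFun (twRealify_reindex_sumCongr e₁ e₂ ((g : GL (α ⊕ β) ℂ) : Matrix (α ⊕ β) (α ⊕ β) ℂ)) w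
  rw [← UForm.coe_relabel, ← UForm.coe_toSp, ← UForm.coe_toSp, ← coe_reindexSp] at h
  exact h

end UForm

section Pair

variable (P Q R S P' Q' R' S' : Type*) [Fintype P] [DecidableEq P] [Fintype Q] [DecidableEq Q] [Fintype R] [DecidableEq R]
  [Fintype S] [DecidableEq S] [Fintype P'] [DecidableEq P'] [Fintype Q'] [DecidableEq Q'] [Fintype R'] [DecidableEq R']
  [Fintype S'] [DecidableEq S']

/-- **`G_∞(P,Q,R,S) ≃ₜ* G_∞(P′,Q′,R′,S′)`** along four bijections, factor by factor. [cite: KonnoKonno2007, §3.1] -/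
def Ginf.relabel (eP : P ≃ P') (eQ : Q ≃ Q') (eR : R ≃ R') (eS : S ≃ S') : Ginf P Q R S ≃ₜ* Ginf P' Q' R' S' :=
  { (UForm.relabel P Q P' Q' eP eQ).toMulEquiv.prodCongr (UForm.relabel R S R' S' eR eS).toMulEquiv with
    continuous_toFun := (UForm.relabel P Q P' Q' eP eQ).continuous.prodMap (UForm.relabel R S R' S' eR eS).continuous
    continuous_invFun :=
      (UForm.relabel P Q P' Q' eP eQ).symm.continuous.prodMap (UForm.relabel R S R' S' eR eS).symm.continuous }

/-- **the relabelling of the block index `DPIdx`** induced by the four bijections. [folklore] -/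
def dpIdxCongr (eP : P ≃ P') (eQ : Q ≃ Q') (eR : R ≃ R') (eS : S ≃ S') : DPIdx P Q R S ≃ DPIdx P' Q' R' S' :=
  Equiv.sumCongr (Equiv.sumCongr (eP.prodCongr eR) (eQ.prodCongr eS)) (Equiv.sumCongr (eP.prodCongr eS) (eQ.prodCongr eR))

variable {P Q R S P' Q' R' S'}

/-- components of `Ginf.relabel`. [folklore] -/
@[simp] theorem Ginf.relabel_apply (eP : P ≃ P') (eQ : Q ≃ Q') (eR : R ≃ R') (eS : S ≃ S') (g : Ginf P Q R S) :
    Ginf.relabel P Q R S P' Q' R' S' eP eQ eR eS g =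
      (UForm.relabel P Q P' Q' eP eQ g.1, UForm.relabel R S R' S' eR eS g.2) := rfl

/-- the big matrix of the relabelled pair element is the relabelled big matrix. [folklore] -/
theorem reindex_dpEquiv_kronecker_relabel (eP : P ≃ P') (eQ : Q ≃ Q') (eR : R ≃ R') (eS : S ≃ S') (g : Ginf P Q R S) :
    Matrix.reindex (dpEquiv P' Q' R' S') (dpEquiv P' Q' R' S')
        ((((UForm.relabel P Q P' Q' eP eQ g.1 : UForm P' Q') : GL (P' ⊕ Q') ℂ) : Matrix (P' ⊕ Q') (P' ⊕ Q') ℂ) ⊗ₖ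
          (((UForm.relabel R S R' S' eR eS g.2 : UForm R' S') : GL (R' ⊕ S') ℂ) : Matrix (R' ⊕ S') (R' ⊕ S') ℂ)) =
      Matrix.reindex (dpIdxCongr P Q R S P' Q' R' S' eP eQ eR eS) (dpIdxCongr P Q R S P' Q' R' S' eP eQ eR eS)
        (Matrix.reindex (dpEquiv P Q R S) (dpEquiv P Q R S)
          (((g.1 : GL (P ⊕ Q) ℂ) : Matrix (P ⊕ Q) (P ⊕ Q) ℂ) ⊗ₖ ((g.2 : GL (R ⊕ S) ℂ) : Matrix (R ⊕ S) (R ⊕ S) ℂ))) := by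
  rw [UForm.coe_relabel, UForm.coe_relabel, Matrix.kroneckerMap_reindex]
  simp only [Matrix.reindex_apply, Matrix.submatrix_submatrix]
  congr 1 <;> (funext x; rcases x with ((⟨p, r⟩ | ⟨q, s⟩) | (⟨p, s⟩ | ⟨q, r⟩)) <;> rfl)

/-- **`ι𝕎` is natural under relabelling** (phase-map form): the action of the relabelled pair element is the original
action conjugated by the relabelling of `DPIdx`. [cite: KonnoKonno2007, §3.1 (3.1); MoeglinVignerasWaldspurger1987, Ch. 1 I.17] -/
theorem coe_ι𝕎_relabel (eP : P ≃ P') (eQ : Q ≃ Q') (eR : R ≃ R') (eS : S ≃ S') (g : Ginf P Q R S) :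
    (⇑((ι𝕎 P' Q' R' S' (Ginf.relabel P Q R S P' Q' R' S' eP eQ eR eS g)).1 :
        ((DPIdx P' Q' R' S' → ℝ) × (DPIdx P' Q' R' S' → ℝ)) ≃ₗ[ℝ] ((DPIdx P' Q' R' S' → ℝ) × (DPIdx P' Q' R' S' → ℝ))) :
        PhaseMap (DPIdx P' Q' R' S')) =
      reindexPhase (dpIdxCongr P Q R S P' Q' R' S' eP eQ eR eS).symm
        (⇑((ι𝕎 P Q R S g).1 :
          ((DPIdx P Q R S → ℝ) × (DPIdx P Q R S → ℝ)) ≃ₗ[ℝ] ((DPIdx P Q R S → ℝ) × (DPIdx P Q R S → ℝ)))) := by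
  funext w
  rw [ι𝕎_apply, Ginf.relabel_apply, reindex_dpEquiv_kronecker_relabel, dpIdxCongr, twRealify_reindex_sumCongr]
  rfl

/-- `reindexSp ε ∘ reindexSp ε⁻¹ = id`. [folklore] -/
theorem reindexSp_reindexSp_symm {σ σ' : Type*} [Fintype σ] [Fintype σ'] (ε : σ ≃ σ')
    (g : symplecticGroup (polar (dotPairing σ))) : reindexSp ε (reindexSp ε.symm g) = g := by
  apply Subtype.ext
  apply LinearEquiv.ext
  intro pq
  rw [coe_reindexSp_apply, coe_reindexSp_apply]
  simp only [reindexPV_apply, reindexPV_symm_apply, Equiv.symm_symm, Function.comp_assoc, Equiv.symm_comp_self,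
    Function.comp_id, Prod.mk.eta]

/-- `reindexSp ε⁻¹ ∘ reindexSp ε = id`. [folklore] -/
theorem reindexSp_symm_reindexSp {σ σ' : Type*} [Fintype σ] [Fintype σ'] (ε : σ ≃ σ')
    (g : symplecticGroup (polar (dotPairing σ'))) : reindexSp ε.symm (reindexSp ε g) = g := by
  have h := reindexSp_reindexSp_symm ε.symm g
  rwa [Equiv.symm_symm] at h

/-- **`ι𝕎` is natural under relabelling** (homomorphism form). [cite: KonnoKonno2007, §3.1 (3.1)] -/
theorem ι𝕎_relabel (eP : P ≃ P') (eQ : Q ≃ Q') (eR : R ≃ R') (eS : S ≃ S') (g : Ginf P Q R S) :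
    ι𝕎 P' Q' R' S' (Ginf.relabel P Q R S P' Q' R' S' eP eQ eR eS g) =
      reindexSp (dpIdxCongr P Q R S P' Q' R' S' eP eQ eR eS).symm (ι𝕎 P Q R S g) := by
  apply Subtype.ext
  apply LinearEquiv.ext
  intro w
  have h := congrFun (coe_ι𝕎_relabel eP eQ eR eS g) w
  rwa [← coe_reindexSp] at h

/-- … equivalently `reindexSp (dpIdxCongr …) (ι𝕎′ (relabel g)) = ι𝕎 g`. [cite: KonnoKonno2007, §3.1 (3.1)] -/
theorem reindexSp_dpIdxCongr_ι𝕎_relabel (eP : P ≃ P') (eQ : Q ≃ Q') (eR : R ≃ R') (eS : S ≃ S') (g : Ginf P Q R S) :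
    reindexSp (dpIdxCongr P Q R S P' Q' R' S' eP eQ eR eS)
        (ι𝕎 P' Q' R' S' (Ginf.relabel P Q R S P' Q' R' S' eP eQ eR eS g)) = ι𝕎 P Q R S g := by
  rw [ι𝕎_relabel, reindexSp_reindexSp_symm]

end Pair

/-! ## §3 Block phase maps under relabelling; the consumer's step -/

section Block

variable {σ₁ σ₁' σ₂ σ₂' : Type*}

/-- relabelling along the identity does nothing. [folklore] -/
@[simp] theorem reindexPhase_refl (φ : PhaseMap σ₁) : reindexPhase (Equiv.refl σ₁) φ = φ := by
  funext pq
  simp only [reindexPhase_apply, Equiv.refl_symm, Equiv.coe_refl, Function.comp_id, Prod.mk.eta]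

/-- **relabelling a block phase map block by block.** [cite: Weil1964, Chap. I n° 12, p. 160] -/
theorem reindexPhase_sumCongr_blockPhase (e₁ : σ₁ ≃ σ₁') (e₂ : σ₂ ≃ σ₂') (φ : PhaseMap σ₁') (ψ : PhaseMap σ₂') :
    reindexPhase (Equiv.sumCongr e₁ e₂) (blockPhase φ ψ) = blockPhase (reindexPhase e₁ φ) (reindexPhase e₂ ψ) := by
  funext pq
  obtain ⟨p, q⟩ := pq
  refine Prod.ext (funext fun k => ?_) (funext fun k => ?_) <;> rcases k with i | j <;>
    simp only [reindexPhase_apply, blockPhase, Function.comp_def, Equiv.sumCongr_symm, Equiv.sumCongr_apply,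
      Sum.map_inl, Sum.map_inr, Sum.elim_inl, Sum.elim_inr]

variable {P Q R S P' Q' R' S' : Type*} [Fintype P] [DecidableEq P] [Fintype Q] [DecidableEq Q] [Fintype R]
  [DecidableEq R] [Fintype S] [DecidableEq S] [Fintype P'] [DecidableEq P'] [Fintype Q'] [DecidableEq Q']
  [Fintype R'] [DecidableEq R'] [Fintype S'] [DecidableEq S'] [Fintype σ₂]

/-- **The consumer's step.**  If an element `γ` of `Sp(ℝ^{DPIdx P Q R S ⊕ σ₂} × …)` acts by the block of `ι𝕎 P Q R S u`
and the identity (the shape produced by `Weil1964/ArchPlacePhaseHomBlock` for an element supported at one place), then after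
relabelling the first block by `dpIdxCongr` it acts by the block of `ι𝕎 P′ Q′ R′ S′ (relabel u)` and the identity — the
hypothesis `hs` of a block pair (`IsArchWeilDatum.exists_circle_twist_factorisation_clm`, `Model/ArchKTypeJunction` § 2) in the
relabelled frame. [cite: KonnoKonno2007, §3.1 (3.1); Weil1964, Chap. I n° 12, p. 160] -/
theorem coe_reindexSp_sumCongr_of_eq_blockPhase (eP : P ≃ P') (eQ : Q ≃ Q') (eR : R ≃ R') (eS : S ≃ S')
    (γ : symplecticGroup (polar (dotPairing (DPIdx P Q R S ⊕ σ₂)))) (u : Ginf P Q R S)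
    (hγ : (⇑(γ.1 : ((DPIdx P Q R S ⊕ σ₂ → ℝ) × (DPIdx P Q R S ⊕ σ₂ → ℝ)) ≃ₗ[ℝ]
          ((DPIdx P Q R S ⊕ σ₂ → ℝ) × (DPIdx P Q R S ⊕ σ₂ → ℝ))) : PhaseMap (DPIdx P Q R S ⊕ σ₂)) =
      blockPhase (⇑((ι𝕎 P Q R S u).1 :
        ((DPIdx P Q R S → ℝ) × (DPIdx P Q R S → ℝ)) ≃ₗ[ℝ] ((DPIdx P Q R S → ℝ) × (DPIdx P Q R S → ℝ)))) id) :
    (⇑((reindexSp (Equiv.sumCongr (dpIdxCongr P Q R S P' Q' R' S' eP eQ eR eS).symm (Equiv.refl σ₂)) γ).1 :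
        ((DPIdx P' Q' R' S' ⊕ σ₂ → ℝ) × (DPIdx P' Q' R' S' ⊕ σ₂ → ℝ)) ≃ₗ[ℝ]
          ((DPIdx P' Q' R' S' ⊕ σ₂ → ℝ) × (DPIdx P' Q' R' S' ⊕ σ₂ → ℝ))) : PhaseMap (DPIdx P' Q' R' S' ⊕ σ₂)) =
      blockPhase (⇑((ι𝕎 P' Q' R' S' (Ginf.relabel P Q R S P' Q' R' S' eP eQ eR eS u)).1 :
        ((DPIdx P' Q' R' S' → ℝ) × (DPIdx P' Q' R' S' → ℝ)) ≃ₗ[ℝ] ((DPIdx P' Q' R' S' → ℝ) × (DPIdx P' Q' R' S' → ℝ))))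
        id := by
  rw [coe_reindexSp, hγ, reindexPhase_sumCongr_blockPhase, coe_ι𝕎_relabel, reindexPhase_refl]

end Block

end RealDualPair

end Literature.RepresentationTheory.KonnoKonno2007
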